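import Literature.NumberTheory.ComplexMultiplication.WeilNumberOnePlusPrimeInvariants
import HarnessLib

/-!
# Milne 1999 §5 «The reduction functor» on fundamental groups: `Ψ ↦ Π(Ψ)`, `X^*(T^Ψ) → X^*(L^{Π(Ψ)})`
# («`Σ f(ψ)ψ ↦ Σ f(ψ)π(ψ)`», `t^Ψ ↦ l^Π`), the injective `α′^Ψ : (L^{Π(Ψ)}, l^{Π(Ψ)}) → (T^Ψ, t^Ψ)`, and: every `Γ`-orbit
# `Π ⊂ W^K_{1,+}(p^∞)` is a `Π(Ψ)` (J. S. Milne, *Lefschetz motives and the Tate conjecture*, Compositio Math. 117 (1999), §5 pp. 64–65)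

Family `hodge`, lane `lit-hodgefound` (Layer A3; seat `lit-hodgefound-p27`, generation 16, row g16-#6); topic
`Literature/NumberTheory/ComplexMultiplication`, namespaces `Literature.NumberTheory.ComplexMultiplication.OrbitTorus` (§0, generic) and
`….CMNumbers`.  ELEVENTH FILE of the seat's Milne-1999 series; sequel of g16-#5 `WeilNumberOnePlusPrimeInvariants`
(`mem_weilLimitInOnePlus_iff_fInvLim`), g16-#4 `WeilTorusToOrbitToriInjective` (`weilLimitInOnePlus = W^K_{1,+}(p^∞)`, CM types on
`Hom(K, ℚ^{cm})`, `toMul_alphaCharOfPrime_mem_weilLimitInOnePlus`), g16-#3 (`FibreSum`, `fInvLim`, `exists_infinityTypes_sum_fibre_eq`),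
g16-#2 (`fInvHom_alphaUnitIn` = (5.1), `autEquivEmb`), g15-#5 (`alphaCharOfPrime = π`), g15-#3 (`weilOrbitChar = X^*(L^Π)`, `lWeil = l^Π`,
`weilOrbitTorusPoints = L^Π(R)`), Q731 `CMTypeOrbitTorus` (`OrbitTorus.CharModule`, `rep`, `tChar`, `congr`) and Q768 (`torusPoints`).  Small
carriers with bodies (`OrbitTorus.pushFun`/`push`; `cmTypeChar = λ_Φ`, `cmTypeGerm = π(Φ)`, `orbitRed = (Ψ → Π(Ψ))`, `cmOrbitChar = X^*(T^Ψ)`,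
`cmOrbitRep`, `tCM = t^Ψ`, `redChar`, `cmOrbitTorusPoints = T^Ψ(R)`, `tCMPoints`, `alphaPrimePoints = α′^Ψ`, `FibreSum.liftSet`) + THEOREMS;
no named fact (D-0026, net debt 0).

THE PRINT.  [Milne1999] §5 p. 64 (last lines) – p. 65 L1–L9 (held `paper:doi-10-1023-a-1000776613765` p0020–p0021), verbatim: «THE REDUCTION
FUNCTOR.  The functor `A ↦ A₀` extends to a functor `R : LCM(ℚ^{al}) → LMot(𝔽)`, `h(A, e, m) ↦ h(A₀, e₀, m)`.  Above, we defined a surjective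
homomorphism `f ↦ π(f) : X^*(S^K) → W^K(p^∞)` which sends CM-types on `K` to Weil integers of weight `−1`. Since the map is
`Γ`-equivariant, to each `Γ`-orbit `Ψ` of CM-types it attaches a `Γ`-orbit `Π(Ψ)` of Weil integers of weight `−1` and a surjective
`Γ`-equivariant homomorphism `Ψ → Π(Ψ)`. This last map induces a surjective homomorphism `Σ_{ψ∈Ψ} f(ψ)ψ ↦ Σ_{ψ∈Ψ} f(ψ)π(ψ) :
X^*(T^Ψ) → X^*(L^Π)` sending `t^Ψ` to `l^Π` and, hence, an injective homomorphism `α′^Ψ : (L^{Π(Ψ)}, l^{Π(Ψ)}) → (T^Ψ, t^Ψ)`.  On combining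
these maps for all `Ψ`, we obtain a injective homomorphism `α′^K : (L^K, l^K) → (T^K, t^K)`.  THEOREM 5.4. The homomorphism
`(L^K, l^K) → (T^K, t^K)` of fundamental groups defined by the reduction functor `LCM^K(ℚ^{al}) → LMot^K(𝔽)` is `α′`.»  (§2 p. 55 L38–L48:
«For a `Γ`-orbit `Ψ` of CM-types … define `T^Ψ` to be the torus over `ℚ` with character group `X^*(T^Ψ) = {f : Ψ → ℤ}/{f | f = ιf and
Σ f(ψ) = 0}`. The element `ψ + ιψ` of `X^*(T^Ψ)` … defines a homomorphism `t^Ψ : T^Ψ → 𝔾_m`».)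

WHAT IS FORMALISED AND HOW.  «Sends CM-types on `K` to Weil integers of weight `−1`» is g16-#4 (`π(λ_Φ) ∈ W^K_{1,+}(p^∞)`); the `Γ`-equivariance
of `π` is g15-#5; from these §2 builds the map `Ψ = ΓΦ₀ → Π(Ψ) = Γπ(Φ₀)`, `ψ ↦ π(ψ)` (equivariant, onto).  §0 supplies, generically for Q731's
character modules `X(S) = R[S]/{f = ιf, Σ f = 0}`, the push-forward `X(S) → X(S′)` along a map of `G`-sets commuting with `ι` (well defined since
`φ_*` preserves `ι`-invariance and the augmentation), its value `t ↦ t`, its equivariance and its surjectivity for `φ` onto; §3 applies it to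
`Ψ → Π(Ψ)`: `X^*(T^Ψ) → X^*(L^{Π(Ψ)})` is onto and sends `t^Ψ` to `l^Π`, so on `R`-points (Q768) `α′^Ψ : L^{Π(Ψ)}(R) → T^Ψ(R)` is injective with
`t^Ψ ∘ α′^Ψ = l^{Π(Ψ)}`.  §4–§5 add what the assembly «for all `Ψ`» into an injective `α′^K` over ALL orbits `Π ⊂ W^K_{1,+}(p^∞)` tacitly uses and
[Milne1999] does not print: EVERY `Π` IS A `Π(Ψ)`, i.e. `π : {CM types of K} → W^K_{1,+}(p^∞)` is onto.  Proof: for `x ∈ W^K_{1,+}(p^∞)` the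
invariants `f = f_x` satisfy `0 ≤ f`, `f(w) + f(ιw) = [K_w : ℚ_p]` (g16-#5); a `{0,1}`-valued refinement of g16-#3's combinatorial lemma
(`FibreSum.liftSet`: in an `ι`-stable fibre take the pair representatives, in a free pair of fibres `fib(w) ∪ fib(ιw)` take a subset `A ⊆ fib(w)` of
size `f(w)` and the complement of `ιA` in `fib(ιw)`) produces a CM type `λ` of `K` with fibre sums `Σ_{σw₀ = w} λ(τ₀σ) = f(w)`, i.e. (5.1)
`f_{π(λ)} = f = f_x`, whence `π(λ) = x` by the injectivity of `[π] ↦ f_π`.  The product `α′^K = (α′^Ψ)_Ψ` itself (an indexed product over orbit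
representatives) is not spelled out; its injectivity is componentwise.

DICTIONARY.  As in g16-#1…#5 (`K` CM, Galois over `ℚ` where marked; `Γ = Gal(ℚ^{cm}/ℚ)`, `ι = cmNumbersConj`; `E = Hom(K, ℚ^{cm})` with `σ•φ = σ∘φ`;
`X^*(S^K) = infinityTypes Γ E ι`; `π = alphaCharOfPrime p 𝔭`, `w₀ = basePrime p 𝔭`, `ϖ` g15-#5's generator of `𝔭^h`).  A CM type of `K` is a
`Φ : Set E` with `IsCMTypeWith ι Φ`; `Γ` acts on `Set E` pointwise (`σ • Φ`); `λ_Φ = cmTypeChar`, `π(Φ) = cmTypeGerm p 𝔭`; for a base CM type `Φ₀`: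
`Ψ = MulAction.orbit Γ Φ₀`, `Π(Ψ) = MulAction.orbit Γ (π Φ₀)`, `Ψ → Π(Ψ) = orbitRed`; `X^*(T^Ψ) = cmOrbitChar ℤ Φ₀` (`cmOrbitRep`, `t^Ψ = tCM`),
`T^Ψ(R) = cmOrbitTorusPoints R Φ₀`, `t^Ψ` on points `tCMPoints`; `X^*(L^Π) = weilOrbitChar ℤ (π Φ₀)`, `l^Π = lWeil`, `L^Π(R) = weilOrbitTorusPoints`
(g15-#3); `X^*(T^Ψ) → X^*(L^Π) = redChar`; `α′^Ψ = alphaPrimePoints p 𝔭 R`.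

WHAT IS HERE (all PROVED):
* §0 (`OrbitTorus`, generic `G`-sets `S → S′`): DEF `pushFun` (`pushFun_single`, `aug_pushFun`, `pushFun_act`, `pushFun_mem_rel`), DEF **`push`**
  (`push_mk`, `push_mk_single`, **`push_tChar`**, **`push_rep`**, **`push_surjective`**).
* §1 `isCMTypeWith_smul_set`, `conj_smul_set_eq_compl`, `indicator_mem_infinityTypes`, DEF **`cmTypeChar`** (`_apply_of_mem/_apply_of_notMem/_nonneg/
  _add_conj`, **`cmTypeChar_smul`**), DEF **`cmTypeGerm = π(Φ)`** (`cmTypeGerm_def`, **`cmTypeGerm_mem_weilLimitInOnePlus`**, `cmTypeGerm_congr`,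
  **`cmTypeGerm_smul`**, `weilLimExp_cmTypeGerm`).
* §2 `isCMTypeWith_of_mem_orbit`, `cmTypeGerm_mem_orbit`, DEF **`orbitRed : Ψ → Π(Ψ)`** (`coe_orbitRed`, `orbitRed_base`, **`orbitRed_smul`**,
  **`orbitRed_surjective`**), `orbit_cmTypeGerm_subset_weilLimitInOnePlus`.
* §3 DEF `cmOrbitChar = X^*(T^Ψ)`, `cmOrbitRep`, `tCM = t^Ψ`, DEF **`redChar : X^*(T^Ψ) → X^*(L^{Π(Ψ)})`** (`redChar_mk_single`, **`redChar_tCM : t^Ψ ↦ l^Π`**,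
  `redChar_rep`, **`redChar_surjective`**), DEF `cmOrbitTorusPoints = T^Ψ(R)`, `tCMPoints`, DEF **`alphaPrimePoints = α′^Ψ`** (`_apply_ofAdd`,
  **`tCMPoints_alphaPrimePoints : t^Ψ ∘ α′^Ψ = l^Π`**, **`alphaPrimePoints_injective`**).
* §4 (`FibreSum`, generic) DEF **`liftSet`** (`liftSet_zeroOne`, **`liftSet_add_liftSet_mul`**, **`sum_fibre_liftSet`**), `exists_choice`,
  **`exists_zeroOne_sum_fibre_eq`**.
* §5 **`exists_zeroOne_infinityTypes_sum_fibre_eq`** (the `{0,1}`-valued Lemma 5.1), `isCMTypeWith_setOf_eq_one`, `coe_cmTypeChar_setOf_eq_one`,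
  **`exists_cmTypeGerm_eq`** (`π` is onto `W^K_{1,+}(p^∞)`), **`exists_orbit_eq_orbit_cmTypeGerm`** (every `Π` is a `Π(Ψ)`).

NOT here: Prop. 5.3 and THEOREM 5.4 themselves (Shimura–Taniyama; the reduction functor on motives), the torus `T^K = ∏_Ψ T^Ψ` and `α′^K` as one
map, §6 (Thm. 6.1 `P = L ∩ S`, Lemma 6.2) — Layer B (B5-09) / later rows.

## References

* [Milne1999] J. S. Milne, *Lefschetz motives and the Tate conjecture*, Compositio Math. 117 (1999) 45–76 — §5 «The reduction functor»
  pp. 64–65 (held `paper:doi-10-1023-a-1000776613765` p0020 L62–L70, p0021 L1–L25); §2 p. 55 L38–L48; §5 p. 63 Lemma 5.1.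
* [MilneShih1982Taniyama] J. S. Milne, K.-y. Shih, *Langlands's construction of the Taniyama group*, LNM 900 (1982) art. III §1 (1.7).
* [MilneCM2006] J. S. Milne, *Complex Multiplication* (course notes), Ch. I §1 Def. 1.8, §4 Def. 4.10.
* [Milne2017] J. S. Milne, *Algebraic Groups*, CUP 2017 — Ch. 12 Thm. 12.9 (Q768 `CharacterModuleTorusPoints`).

Provenance: lane `lit-hodgefound`, seat `lit-hodgefound-p27` gen 16 (agent `literature-prover-lit-hodgefound-p27-g16-0`), row g16-#6
(INBOX 2026-08-23, claim line recorded in the seat sheet).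
-/

set_option autoImplicit false

noncomputable section

open scoped NumberField Pointwise ComplexConjugate TensorProduct

namespace Literature.NumberTheory.ComplexMultiplication

/-! ### §0 Generic: the push-forward `X(S) → X(S′)` along an equivariant map of `G`-sets -/

namespace OrbitTorus

section Push

variable (R : Type*) [CommRing R] {G : Type*} [Group G] {S : Type*} [MulAction G S] {S' : Type*} [MulAction G S']
  (ι : G) (φ : S → S') (hφ : ∀ s : S, φ (ι • s) = ι • φ s)

/-- `φ_* : R[S] → R[S′]`, `δ_s ↦ δ_{φ(s)}` (Mathlib `Finsupp.lmapDomain`). [cite: Milne1999, §5 pp. 64–65 («The reduction functor»)] -/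
def pushFun : (S →₀ R) →ₗ[R] (S' →₀ R) :=
  Finsupp.lmapDomain R R φ

/-- [cite: Milne1999, §5 pp. 64–65 («The reduction functor»)] -/
@[simp] theorem pushFun_single (s : S) (r : R) : pushFun R φ (Finsupp.single s r) = Finsupp.single (φ s) r := by
  simp [pushFun, Finsupp.lmapDomain_apply, Finsupp.mapDomain_single]

/-- `φ_*` preserves the augmentation `Σ_s f(s)`. [cite: Milne1999, §2 p. 55 L38–L48] -/
@[simp] theorem aug_pushFun (f : S →₀ R) : aug R (pushFun R φ f) = aug R f := by
  induction f using Finsupp.induction_linear with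
  | zero => simp
  | add f₁ f₂ h₁ h₂ => simp only [map_add, h₁, h₂]
  | single s n => rw [pushFun_single, aug_single, aug_single]

/-- `φ_*` commutes with the translation by `g` when `φ` is `g`-equivariant. [cite: Milne1999, §2 p. 55 L38–L48] -/
theorem pushFun_act {g : G} (hg : ∀ s : S, φ (g • s) = g • φ s) (f : S →₀ R) :
    pushFun R φ (act R g f) = act R g (pushFun R φ f) := by
  induction f using Finsupp.induction_linear with
  | zero => simp
  | add f₁ f₂ h₁ h₂ => simp only [map_add, h₁, h₂]
  | single s n => rw [act_single, pushFun_single, pushFun_single, act_single, hg]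

include hφ in
/-- For `φ` commuting with `ι`, `φ_*` carries the relation module `{f = ιf, Σ f = 0}` of `S` into that of `S′`. [cite: Milne1999, §2 p. 55 L38–L48] -/
theorem pushFun_mem_rel {f : S →₀ R} (hf : f ∈ rel R S ι) : pushFun R φ f ∈ rel R S' ι := by
  rw [mem_rel_iff] at hf ⊢
  exact ⟨by rw [← pushFun_act R φ hφ, hf.1], by rw [aug_pushFun, hf.2]⟩

/-- **The induced map of character modules `X(S) → X(S′)`, `[f] ↦ [φ_* f]`**, for a map `φ : S → S′` of `G`-sets commuting with `ι`
(the shape of «`Σ f(ψ)ψ ↦ Σ f(ψ)π(ψ) : X^*(T^Ψ) → X^*(L^Π)`»; Q731's `OrbitTorus.congr` is the case of a bijection). [cite: Milne1999, §5 pp. 64–65 («The reduction functor»)] -/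
def push : CharModule R S ι →ₗ[R] CharModule R S' ι :=
  Submodule.mapQ (rel R S ι) (rel R S' ι) (pushFun R φ) fun _ hf => Submodule.mem_comap.mpr (pushFun_mem_rel R ι φ hφ hf)

/-- [cite: Milne1999, §5 pp. 64–65 («The reduction functor»)] -/
@[simp] theorem push_mk (f : S →₀ R) : push R ι φ hφ (Submodule.Quotient.mk f) = Submodule.Quotient.mk (pushFun R φ f) := rfl

/-- `[δ_s] ↦ [δ_{φ(s)}]`. [cite: Milne1999, §5 pp. 64–65 («The reduction functor»)] -/
theorem push_mk_single (s : S) :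
    push R ι φ hφ (Submodule.Quotient.mk (Finsupp.single s 1)) = Submodule.Quotient.mk (Finsupp.single (φ s) 1) := by
  rw [push_mk, pushFun_single]

/-- **`t ↦ t`**: `[δ_{s₀} + δ_{ιs₀}] ↦ [δ_{φ s₀} + δ_{ιφ s₀}]` («sending `t^Ψ` to `l^Π`», generic form). [cite: Milne1999, §5 pp. 64–65 («The reduction functor»)] -/
theorem push_tChar (s₀ : S) : push R ι φ hφ (tChar R ι s₀) = tChar R ι (φ s₀) := by
  rw [tChar, push_mk, map_add, pushFun_single, pushFun_single, hφ]
  rfl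

/-- The induced map is `G`-equivariant when `φ` is (`ι` central). [cite: Milne1999, §5 pp. 64–65 («The reduction functor»)] -/
theorem push_rep (hc : ∀ g : G, ι * g = g * ι) (hG : ∀ (g : G) (s : S), φ (g • s) = g • φ s) (g : G)
    (x : CharModule R S ι) : push R ι φ hφ (rep R S ι hc g x) = rep R S' ι hc g (push R ι φ hφ x) := by
  induction x using Submodule.Quotient.induction_on with | H f => ?_
  rw [rep_mk, push_mk, push_mk, rep_mk, pushFun_act R φ (hG g)]

/-- **The induced map is surjective when `φ` is** («induces a surjective homomorphism»). [cite: Milne1999, §5 pp. 64–65 («The reduction functor»)] -/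
theorem push_surjective (hs : Function.Surjective φ) : Function.Surjective (push R ι φ hφ) := by
  intro x
  induction x using Submodule.Quotient.induction_on with | H f' => ?_
  induction f' using Finsupp.induction_linear with
  | zero => exact ⟨0, by rw [map_zero]; rfl⟩
  | add f₁ f₂ h₁ h₂ =>
    obtain ⟨x₁, hx₁⟩ := h₁
    obtain ⟨x₂, hx₂⟩ := h₂
    exact ⟨x₁ + x₂, by rw [map_add, hx₁, hx₂]; rfl⟩
  | single s' r =>
    obtain ⟨s, rfl⟩ := hs s'
    exact ⟨Submodule.Quotient.mk (Finsupp.single s r), by rw [push_mk, pushFun_single]⟩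

end Push

end OrbitTorus

namespace CMNumbers

open _root_.NumberField IsDedekindDomain Finset
open Literature.NumberTheory.NumberFields (cmNumbers cmNumbersConj coe_cmNumbersConj cmNumbersConj_mul_self cmNumbersConj_comm
  cmNumbersConj_mul_comm)
open Literature.RingTheory.GaloisAlgebras.CharacterModuleTorus (torusPoints galUnits)
open SerreGroupTorus (infinityTypesRep coe_infinityTypesRep_apply serrePoints)

/-! ### §1 The CM types of `K` as a `Γ`-set and their Weil germs `π(Φ)` -/

section CMTypeGerms

variable {K : Type} [Field K] [NumberField K] [IsCMField K]

omit [IsCMField K] in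
/-- Translates `σΦ` of a CM type `Φ ⊂ Hom(K, ℚ^{cm})` by `σ ∈ Γ` are CM types (`ι` is central): the CM types of `K` form a `Γ`-set.
[cite: MilneCM2006, Ch. I §1 Def. 1.8] [cite: Milne1999, §3 p. 59 L1–L3 («Γ-orbit Ψ of CM-types on K»)] -/
theorem isCMTypeWith_smul_set {Φ : Set (K →ₐ[ℚ] cmNumbers)} (h : IsCMTypeWith (cmNumbersConj : cmNumbers ≃ₐ[ℚ] cmNumbers) Φ)
    (σ : cmNumbers ≃ₐ[ℚ] cmNumbers) : IsCMTypeWith (cmNumbersConj : cmNumbers ≃ₐ[ℚ] cmNumbers) (σ • Φ) where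
  mem_iff x := by
    rw [Set.mem_smul_set_iff_inv_smul_mem, Set.mem_smul_set_iff_inv_smul_mem, h.mem_iff, smul_smul, smul_smul,
      ← cmNumbersConj_mul_comm σ⁻¹]
  comm := h.comm
  invol := h.invol

omit [IsCMField K] in
/-- `ιΦ = Φᶜ` for a CM type `Φ`. [cite: MilneCM2006, Ch. I §1 Def. 1.8] -/
theorem conj_smul_set_eq_compl {Φ : Set (K →ₐ[ℚ] cmNumbers)}
    (h : IsCMTypeWith (cmNumbersConj : cmNumbers ≃ₐ[ℚ] cmNumbers) Φ) : cmNumbersConj • Φ = Φᶜ := by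
  ext x
  rw [Set.mem_smul_set_iff_inv_smul_mem, Set.mem_compl_iff, ← h.rho_smul_mem_iff x]
  have hinv : (cmNumbersConj : cmNumbers ≃ₐ[ℚ] cmNumbers)⁻¹ = cmNumbersConj :=
    inv_eq_of_mul_eq_one_right cmNumbersConj_mul_self
  rw [hinv]

/-- The indicator `𝟙_Φ` of a CM type lies in `X^*(S^K)` (skel-3's generators, g16-#4 `span_setOf_zeroOne_eq_infinityTypes_cmNumbers`).
[cite: MilneShih1982Taniyama, §1 (1.7)] -/
theorem indicator_mem_infinityTypes {Φ : Set (K →ₐ[ℚ] cmNumbers)}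
    (h : IsCMTypeWith (cmNumbersConj : cmNumbers ≃ₐ[ℚ] cmNumbers) Φ) [DecidablePred (· ∈ Φ)] :
    Φ.indicator 1 ∈ infinityTypes (cmNumbers ≃ₐ[ℚ] cmNumbers) (K →ₐ[ℚ] cmNumbers) cmNumbersConj := by
  haveI : Nonempty (K →ₐ[ℚ] cmNumbers) := nonempty_algHom_cmNumbers (Or.inr ‹IsCMField K›)
  rw [← h.span_setOf_zeroOne_eq_infinityTypes]
  refine Submodule.subset_span ⟨fun τ => ?_, fun τ => ?_⟩
  · by_cases hτ : τ ∈ Φ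
    · exact Or.inr (by simp [Set.indicator_of_mem hτ])
    · exact Or.inl (by simp [Set.indicator_of_notMem hτ])
  · by_cases hτ : τ ∈ Φ
    · have hτ' : cmNumbersConj • τ ∉ Φ := (h.mem_iff τ).mp hτ
      simp [Set.indicator_of_mem hτ, Set.indicator_of_notMem hτ']
    · have hτ' : cmNumbersConj • τ ∈ Φ := (h.rho_smul_mem_iff τ).mpr hτ
      simp [Set.indicator_of_mem hτ', Set.indicator_of_notMem hτ]

open scoped Classical in
/-- **The CM type `Φ` as the character `λ_Φ = 𝟙_Φ ∈ X^*(S^K)`** («CM-types on `K`» inside `X^*(S^K)`: `λ(σ) ∈ {0, 1}`, `λ(σ) + λ(ισ) = 1`).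
[cite: MilneShih1982Taniyama, §1 (1.7)] [cite: Milne1999, §5 pp. 64–65 («The reduction functor»)] -/
def cmTypeChar {Φ : Set (K →ₐ[ℚ] cmNumbers)} (h : IsCMTypeWith (cmNumbersConj : cmNumbers ≃ₐ[ℚ] cmNumbers) Φ) :
    infinityTypes (cmNumbers ≃ₐ[ℚ] cmNumbers) (K →ₐ[ℚ] cmNumbers) cmNumbersConj :=
  ⟨Φ.indicator 1, indicator_mem_infinityTypes h⟩

/-- `λ_Φ = 1` on `Φ`. [cite: MilneShih1982Taniyama, §1 (1.7)] -/
theorem cmTypeChar_apply_of_mem {Φ : Set (K →ₐ[ℚ] cmNumbers)} (h : IsCMTypeWith (cmNumbersConj : cmNumbers ≃ₐ[ℚ] cmNumbers) Φ)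
    {τ : K →ₐ[ℚ] cmNumbers} (hτ : τ ∈ Φ) : (cmTypeChar h : (K →ₐ[ℚ] cmNumbers) → ℤ) τ = 1 := by
  classical
  change Φ.indicator 1 τ = 1
  simp [Set.indicator_of_mem hτ]

/-- `λ_Φ = 0` off `Φ`. [cite: MilneShih1982Taniyama, §1 (1.7)] -/
theorem cmTypeChar_apply_of_notMem {Φ : Set (K →ₐ[ℚ] cmNumbers)}
    (h : IsCMTypeWith (cmNumbersConj : cmNumbers ≃ₐ[ℚ] cmNumbers) Φ) {τ : K →ₐ[ℚ] cmNumbers} (hτ : τ ∉ Φ) :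
    (cmTypeChar h : (K →ₐ[ℚ] cmNumbers) → ℤ) τ = 0 := by
  classical
  change Φ.indicator 1 τ = 0
  simp [Set.indicator_of_notMem hτ]

/-- `λ_Φ ≥ 0`. [cite: MilneShih1982Taniyama, §1 (1.7)] -/
theorem cmTypeChar_nonneg {Φ : Set (K →ₐ[ℚ] cmNumbers)} (h : IsCMTypeWith (cmNumbersConj : cmNumbers ≃ₐ[ℚ] cmNumbers) Φ)
    (τ : K →ₐ[ℚ] cmNumbers) : 0 ≤ (cmTypeChar h : (K →ₐ[ℚ] cmNumbers) → ℤ) τ := by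
  by_cases hτ : τ ∈ Φ
  · rw [cmTypeChar_apply_of_mem h hτ]; exact zero_le_one
  · rw [cmTypeChar_apply_of_notMem h hτ]

/-- `λ_Φ(τ) + λ_Φ(ιτ) = 1` (a CM type has weight `−1`). [cite: MilneShih1982Taniyama, §1 (1.7)] [cite: MilneCM2006, Ch. I §4 Def. 4.10] -/
theorem cmTypeChar_add_conj {Φ : Set (K →ₐ[ℚ] cmNumbers)} (h : IsCMTypeWith (cmNumbersConj : cmNumbers ≃ₐ[ℚ] cmNumbers) Φ)
    (τ : K →ₐ[ℚ] cmNumbers) :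
    (cmTypeChar h : (K →ₐ[ℚ] cmNumbers) → ℤ) τ + (cmTypeChar h : (K →ₐ[ℚ] cmNumbers) → ℤ) (cmNumbersConj • τ) = 1 := by
  by_cases hτ : τ ∈ Φ
  · rw [cmTypeChar_apply_of_mem h hτ, cmTypeChar_apply_of_notMem h ((h.mem_iff τ).mp hτ), add_zero]
  · rw [cmTypeChar_apply_of_notMem h hτ, cmTypeChar_apply_of_mem h ((h.rho_smul_mem_iff τ).mpr hτ), zero_add]

/-- **`λ_{σΦ} = σ·λ_Φ`**: `Φ ↦ λ_Φ` is `Γ`-equivariant for the action `(σF)(τ) = F(σ⁻¹τ)` on `X^*(S^K)` (skel-3 `characterRep`).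
[cite: Milne1999, §5 pp. 64–65 («The reduction functor») («Since the map is Γ-equivariant»)] -/
theorem cmTypeChar_smul {Φ : Set (K →ₐ[ℚ] cmNumbers)} (h : IsCMTypeWith (cmNumbersConj : cmNumbers ≃ₐ[ℚ] cmNumbers) Φ)
    (σ : cmNumbers ≃ₐ[ℚ] cmNumbers) :
    cmTypeChar (isCMTypeWith_smul_set h σ) =
      infinityTypesRep (cmNumbers ≃ₐ[ℚ] cmNumbers) (K →ₐ[ℚ] cmNumbers) cmNumbersConj σ (cmTypeChar h) := by
  apply Subtype.ext
  funext τ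
  rw [coe_infinityTypesRep_apply, characterRep_apply]
  by_cases hτ : τ ∈ σ • Φ
  · rw [cmTypeChar_apply_of_mem _ hτ, cmTypeChar_apply_of_mem h (Set.mem_smul_set_iff_inv_smul_mem.mp hτ)]
  · rw [cmTypeChar_apply_of_notMem _ hτ,
      cmTypeChar_apply_of_notMem h (fun h' => hτ (Set.mem_smul_set_iff_inv_smul_mem.mpr h'))]

variable (p : ℕ) [hp : Fact p.Prime] (𝔭 : Ideal (𝓞 K)) [h𝔭 : 𝔭.LiesOver (Ideal.span {(p : ℤ)})] [h𝔭P : 𝔭.IsPrime]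
variable (τ₀ : K →ₐ[ℚ] cmNumbers)

/-- **`π(Φ) = [λ_Φ(ϖ)] ∈ W(p^∞)`, THE WEIL GERM OF THE CM TYPE `Φ`** — g15-#5's `π = alphaCharOfPrime p 𝔭` («`f ↦ π(f) : X^*(S^K) → W^K(p^∞)`»)
at `λ_Φ` («which sends CM-types on `K` to Weil integers of weight `−1`»). [cite: Milne1999, §5 pp. 64–65 («The reduction functor»)] -/
def cmTypeGerm {Φ : Set (K →ₐ[ℚ] cmNumbers)} (h : IsCMTypeWith (cmNumbersConj : cmNumbers ≃ₐ[ℚ] cmNumbers) Φ) : WeilLimit p :=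
  Additive.toMul (alphaCharOfPrime p 𝔭 (cmTypeChar h))

/-- [cite: Milne1999, §5 pp. 64–65 («The reduction functor»)] -/
theorem cmTypeGerm_def {Φ : Set (K →ₐ[ℚ] cmNumbers)} (h : IsCMTypeWith (cmNumbersConj : cmNumbers ≃ₐ[ℚ] cmNumbers) Φ) :
    cmTypeGerm p 𝔭 h = Additive.toMul (alphaCharOfPrime p 𝔭 (cmTypeChar h)) := rfl

/-- **«sends CM-types on `K` to Weil integers of weight `−1`»**: `π(Φ) ∈ W^K_{1,+}(p^∞)` (g16-#4 `toMul_alphaCharOfPrime_mem_weilLimitInOnePlus`;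
`K` normal). [cite: Milne1999, §5 pp. 64–65 («The reduction functor»)] -/
theorem cmTypeGerm_mem_weilLimitInOnePlus [Normal ℚ K] {Φ : Set (K →ₐ[ℚ] cmNumbers)}
    (h : IsCMTypeWith (cmNumbersConj : cmNumbers ≃ₐ[ℚ] cmNumbers) Φ) : cmTypeGerm p 𝔭 h ∈ weilLimitInOnePlus K p τ₀ :=
  toMul_alphaCharOfPrime_mem_weilLimitInOnePlus p 𝔭 τ₀ (cmTypeChar h) (cmTypeChar_nonneg h) (cmTypeChar_add_conj h τ₀)

/-- `π(Φ)` depends only on the set `Φ` (proof-irrelevance helper). [cite: Milne1999, §5 pp. 64–65 («The reduction functor»)] -/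
theorem cmTypeGerm_congr {Φ Φ' : Set (K →ₐ[ℚ] cmNumbers)} (h : IsCMTypeWith (cmNumbersConj : cmNumbers ≃ₐ[ℚ] cmNumbers) Φ)
    (h' : IsCMTypeWith (cmNumbersConj : cmNumbers ≃ₐ[ℚ] cmNumbers) Φ') (e : Φ = Φ') : cmTypeGerm p 𝔭 h = cmTypeGerm p 𝔭 h' := by
  subst e
  rfl

/-- **`π(σΦ) = σ·π(Φ)`** («Since the map is `Γ`-equivariant», g15-#5 `alphaCharOfPrime_infinityTypesRep`). [cite: Milne1999, §5 pp. 64–65 («The reduction functor»)] -/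
theorem cmTypeGerm_smul {Φ : Set (K →ₐ[ℚ] cmNumbers)} (h : IsCMTypeWith (cmNumbersConj : cmNumbers ≃ₐ[ℚ] cmNumbers) Φ)
    (σ : cmNumbers ≃ₐ[ℚ] cmNumbers) : cmTypeGerm p 𝔭 (isCMTypeWith_smul_set h σ) = σ • cmTypeGerm p 𝔭 h := by
  rw [cmTypeGerm_def, cmTypeGerm_def, cmTypeChar_smul, alphaCharOfPrime_infinityTypesRep, weilLimRep_apply, toMul_ofMul]

/-- `π(Φ)` has weight `−1` (`weilLimExp = 1` in g15-#3's convention). [cite: Milne1999, §5 pp. 64–65 («The reduction functor»)] -/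
theorem weilLimExp_cmTypeGerm [Normal ℚ K] {Φ : Set (K →ₐ[ℚ] cmNumbers)}
    (h : IsCMTypeWith (cmNumbersConj : cmNumbers ≃ₐ[ℚ] cmNumbers) Φ) : weilLimExp (cmTypeGerm p 𝔭 h) = 1 := by
  obtain ⟨τ₀⟩ := nonempty_algHom_cmNumbers (K := K) (Or.inr ‹IsCMField K›)
  exact weilLimExp_eq_one_of_mem_weilLimitInOnePlus p τ₀ (cmTypeGerm_mem_weilLimitInOnePlus p 𝔭 τ₀ h)

end CMTypeGerms

/-! ### §2 `Ψ ↦ Π(Ψ)`: the orbit of Weil germs attached to an orbit of CM types -/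

section Orbits

variable {K : Type} [Field K] [NumberField K] [IsCMField K]
variable (p : ℕ) [hp : Fact p.Prime] (𝔭 : Ideal (𝓞 K)) [h𝔭 : 𝔭.LiesOver (Ideal.span {(p : ℤ)})] [h𝔭P : 𝔭.IsPrime]

omit [IsCMField K] in
/-- Every member of the `Γ`-orbit `Ψ = ΓΦ₀` of a CM type is a CM type. [cite: Milne1999, §5 pp. 64–65 («The reduction functor») («to each Γ-orbit Ψ of CM-types»)] -/
theorem isCMTypeWith_of_mem_orbit {Φ₀ : Set (K →ₐ[ℚ] cmNumbers)} (h₀ : IsCMTypeWith (cmNumbersConj : cmNumbers ≃ₐ[ℚ] cmNumbers) Φ₀)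
    (ψ : MulAction.orbit (cmNumbers ≃ₐ[ℚ] cmNumbers) Φ₀) :
    IsCMTypeWith (cmNumbersConj : cmNumbers ≃ₐ[ℚ] cmNumbers) (ψ : Set (K →ₐ[ℚ] cmNumbers)) := by
  obtain ⟨σ, hσ⟩ := MulAction.mem_orbit_iff.mp ψ.2
  rw [← hσ]
  exact isCMTypeWith_smul_set h₀ σ

/-- For `ψ = σΦ₀ ∈ Ψ`, `π(ψ) = σπ(Φ₀)` lies in the orbit `Π(Ψ) := Γ·π(Φ₀)`. [cite: Milne1999, §5 pp. 64–65 («The reduction functor»)] -/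
theorem cmTypeGerm_mem_orbit {Φ₀ : Set (K →ₐ[ℚ] cmNumbers)} (h₀ : IsCMTypeWith (cmNumbersConj : cmNumbers ≃ₐ[ℚ] cmNumbers) Φ₀)
    (ψ : MulAction.orbit (cmNumbers ≃ₐ[ℚ] cmNumbers) Φ₀) :
    cmTypeGerm p 𝔭 (isCMTypeWith_of_mem_orbit h₀ ψ) ∈ MulAction.orbit (cmNumbers ≃ₐ[ℚ] cmNumbers) (cmTypeGerm p 𝔭 h₀) := by
  obtain ⟨σ, hσ⟩ := MulAction.mem_orbit_iff.mp ψ.2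
  have hψ : cmTypeGerm p 𝔭 (isCMTypeWith_of_mem_orbit h₀ ψ) = cmTypeGerm p 𝔭 (isCMTypeWith_smul_set h₀ σ) := by
    congr 1
    exact hσ.symm
  rw [hψ, cmTypeGerm_smul]
  exact MulAction.mem_orbit _ σ

/-- **`Ψ → Π(Ψ)`, `ψ ↦ π(ψ)`** («it attaches a `Γ`-orbit `Π(Ψ)` of Weil integers of weight `−1` and a surjective `Γ`-equivariant homomorphism
`Ψ → Π(Ψ)`»), with `Π(Ψ)` realised as the orbit of `π(Φ₀)` for the base point `Φ₀` of `Ψ`. [cite: Milne1999, §5 pp. 64–65 («The reduction functor»)] -/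
def orbitRed {Φ₀ : Set (K →ₐ[ℚ] cmNumbers)} (h₀ : IsCMTypeWith (cmNumbersConj : cmNumbers ≃ₐ[ℚ] cmNumbers) Φ₀)
    (ψ : MulAction.orbit (cmNumbers ≃ₐ[ℚ] cmNumbers) Φ₀) :
    MulAction.orbit (cmNumbers ≃ₐ[ℚ] cmNumbers) (cmTypeGerm p 𝔭 h₀) :=
  ⟨cmTypeGerm p 𝔭 (isCMTypeWith_of_mem_orbit h₀ ψ), cmTypeGerm_mem_orbit p 𝔭 h₀ ψ⟩

/-- [cite: Milne1999, §5 pp. 64–65 («The reduction functor»)] -/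
@[simp] theorem coe_orbitRed {Φ₀ : Set (K →ₐ[ℚ] cmNumbers)} (h₀ : IsCMTypeWith (cmNumbersConj : cmNumbers ≃ₐ[ℚ] cmNumbers) Φ₀)
    (ψ : MulAction.orbit (cmNumbers ≃ₐ[ℚ] cmNumbers) Φ₀) :
    ((orbitRed p 𝔭 h₀ ψ : MulAction.orbit (cmNumbers ≃ₐ[ℚ] cmNumbers) (cmTypeGerm p 𝔭 h₀)) : WeilLimit p) =
      cmTypeGerm p 𝔭 (isCMTypeWith_of_mem_orbit h₀ ψ) := rfl

/-- The base point `Φ₀` of `Ψ` goes to the base point `π(Φ₀)` of `Π(Ψ)`. [cite: Milne1999, §5 pp. 64–65 («The reduction functor»)] -/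
theorem orbitRed_base {Φ₀ : Set (K →ₐ[ℚ] cmNumbers)} (h₀ : IsCMTypeWith (cmNumbersConj : cmNumbers ≃ₐ[ℚ] cmNumbers) Φ₀) :
    orbitRed p 𝔭 h₀ ⟨Φ₀, MulAction.mem_orbit_self Φ₀⟩ = ⟨cmTypeGerm p 𝔭 h₀, MulAction.mem_orbit_self _⟩ := rfl

/-- **`Ψ → Π(Ψ)` is `Γ`-equivariant.** [cite: Milne1999, §5 p. 65 L1 («Γ-equivariant»)] -/
theorem orbitRed_smul {Φ₀ : Set (K →ₐ[ℚ] cmNumbers)} (h₀ : IsCMTypeWith (cmNumbersConj : cmNumbers ≃ₐ[ℚ] cmNumbers) Φ₀)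
    (σ : cmNumbers ≃ₐ[ℚ] cmNumbers) (ψ : MulAction.orbit (cmNumbers ≃ₐ[ℚ] cmNumbers) Φ₀) :
    orbitRed p 𝔭 h₀ (σ • ψ) = σ • orbitRed p 𝔭 h₀ ψ := by
  apply Subtype.ext
  change cmTypeGerm p 𝔭 (isCMTypeWith_of_mem_orbit h₀ (σ • ψ)) = σ • cmTypeGerm p 𝔭 (isCMTypeWith_of_mem_orbit h₀ ψ)
  rw [← cmTypeGerm_smul p 𝔭 (isCMTypeWith_of_mem_orbit h₀ ψ) σ]
  exact cmTypeGerm_congr p 𝔭 _ _ MulAction.orbit.coe_smul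

/-- **`Ψ → Π(Ψ)` is surjective.** [cite: Milne1999, §5 p. 65 L1 («surjective»)] -/
theorem orbitRed_surjective {Φ₀ : Set (K →ₐ[ℚ] cmNumbers)} (h₀ : IsCMTypeWith (cmNumbersConj : cmNumbers ≃ₐ[ℚ] cmNumbers) Φ₀) : Function.Surjective (orbitRed p 𝔭 h₀) := by
  rintro ⟨x, hx⟩
  obtain ⟨σ, rfl⟩ := MulAction.mem_orbit_iff.mp hx
  refine ⟨σ • ⟨Φ₀, MulAction.mem_orbit_self Φ₀⟩, ?_⟩
  rw [orbitRed_smul, orbitRed_base]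
  rfl

/-- `Π(Ψ) ⊂ W^K_{1,+}(p^∞)` («a `Γ`-orbit `Π(Ψ)` of Weil integers of weight `−1`»; `K` Galois). [cite: Milne1999, §5 pp. 64–65 («The reduction functor»)] -/
theorem orbit_cmTypeGerm_subset_weilLimitInOnePlus [IsGalois ℚ K] {Φ₀ : Set (K →ₐ[ℚ] cmNumbers)} (h₀ : IsCMTypeWith (cmNumbersConj : cmNumbers ≃ₐ[ℚ] cmNumbers) Φ₀)
    (τ₀ : K →ₐ[ℚ] cmNumbers) :
    (MulAction.orbit (cmNumbers ≃ₐ[ℚ] cmNumbers) (cmTypeGerm p 𝔭 h₀) : Set (WeilLimit p)) ⊆ weilLimitInOnePlus K p τ₀ :=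
  orbit_subset_weilLimitInOnePlus p τ₀ (cmTypeGerm_mem_weilLimitInOnePlus p 𝔭 τ₀ h₀)

end Orbits

/-! ### §3 `X^*(T^Ψ) → X^*(L^{Π(Ψ)})`, `Σ f(ψ)ψ ↦ Σ f(ψ)π(ψ)`, and `α′^Ψ : L^{Π(Ψ)} → T^Ψ` -/

section AlphaPrime

variable {K : Type} [Field K] [NumberField K] [IsCMField K]
variable (p : ℕ) [hp : Fact p.Prime] (𝔭 : Ideal (𝓞 K)) [h𝔭 : 𝔭.LiesOver (Ideal.span {(p : ℤ)})] [h𝔭P : 𝔭.IsPrime]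

/-- **`X^*(T^Ψ)` for the `Γ`-orbit `Ψ = ΓΦ₀` of a CM type `Φ₀` of `K`**: `{f : Ψ → R}/{f = ιf, Σ f = 0}`, Q731's `OrbitTorus.CharModule` for the
`Γ`-set `Ψ ⊂ Set (Hom(K, ℚ^{cm}))` (Q731 took `Ψ` an orbit of CM types on `ℚ^{cm}`; here the orbit of a CM type of the finite `K`, as in §3/§5 of the
paper). [cite: Milne1999, §2 p. 55 L38–L45, §3 p. 59 L1–L4] -/
abbrev cmOrbitChar (R : Type*) [CommRing R] (Φ₀ : Set (K →ₐ[ℚ] cmNumbers)) : Type _ :=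
  OrbitTorus.CharModule R (MulAction.orbit (cmNumbers ≃ₐ[ℚ] cmNumbers) Φ₀) (cmNumbersConj : cmNumbers ≃ₐ[ℚ] cmNumbers)

/-- `X^*(T^Ψ)` as a `Γ`-module (`ι` central). [cite: Milne1999, §2 p. 55 L38–L47] -/
def cmOrbitRep (R : Type*) [CommRing R] (Φ₀ : Set (K →ₐ[ℚ] cmNumbers)) :
    Representation R (cmNumbers ≃ₐ[ℚ] cmNumbers) (cmOrbitChar R Φ₀) :=
  OrbitTorus.rep R _ cmNumbersConj cmNumbersConj_mul_comm

/-- **`t^Ψ = [ψ + ιψ] ∈ X^*(T^Ψ)`** (at the base point; independent of it, Q731 `tChar_eq`). [cite: Milne1999, §2 p. 55 L45–L48] -/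
def tCM (R : Type*) [CommRing R] (Φ₀ : Set (K →ₐ[ℚ] cmNumbers)) : cmOrbitChar R Φ₀ :=
  OrbitTorus.tChar R cmNumbersConj (⟨Φ₀, MulAction.mem_orbit_self Φ₀⟩ : MulAction.orbit (cmNumbers ≃ₐ[ℚ] cmNumbers) Φ₀)

/-- **`X^*(T^Ψ) → X^*(L^{Π(Ψ)})`, «`Σ_{ψ∈Ψ} f(ψ)ψ ↦ Σ_{ψ∈Ψ} f(ψ)π(ψ)`»** — the push-forward of §0 along `Ψ → Π(Ψ)` into g15-#3's
`X^*(L^Π) = weilOrbitChar ℤ (π Φ₀)`. [cite: Milne1999, §5 p. 65 L2–L5] -/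
def redChar {Φ₀ : Set (K →ₐ[ℚ] cmNumbers)} (h₀ : IsCMTypeWith (cmNumbersConj : cmNumbers ≃ₐ[ℚ] cmNumbers) Φ₀) : cmOrbitChar ℤ Φ₀ →ₗ[ℤ] weilOrbitChar ℤ (cmTypeGerm p 𝔭 h₀) :=
  OrbitTorus.push ℤ cmNumbersConj (orbitRed p 𝔭 h₀) fun ψ => orbitRed_smul p 𝔭 h₀ cmNumbersConj ψ

/-- On generators: `[δ_ψ] ↦ [δ_{π(ψ)}]` (the printed formula on `f = δ_ψ`). [cite: Milne1999, §5 p. 65 L2–L5] -/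
theorem redChar_mk_single {Φ₀ : Set (K →ₐ[ℚ] cmNumbers)} (h₀ : IsCMTypeWith (cmNumbersConj : cmNumbers ≃ₐ[ℚ] cmNumbers) Φ₀)
    (ψ : MulAction.orbit (cmNumbers ≃ₐ[ℚ] cmNumbers) Φ₀) :
    redChar p 𝔭 h₀ (Submodule.Quotient.mk (Finsupp.single ψ 1)) = Submodule.Quotient.mk (Finsupp.single (orbitRed p 𝔭 h₀ ψ) 1) :=
  OrbitTorus.push_mk_single ℤ cmNumbersConj _ _ ψ

/-- **«sending `t^Ψ` to `l^Π`»** (g15-#3 `lWeil = l^Π`). [cite: Milne1999, §5 p. 65 L5] -/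
theorem redChar_tCM {Φ₀ : Set (K →ₐ[ℚ] cmNumbers)} (h₀ : IsCMTypeWith (cmNumbersConj : cmNumbers ≃ₐ[ℚ] cmNumbers) Φ₀) :
    redChar p 𝔭 h₀ (tCM ℤ Φ₀) = lWeil ℤ (cmTypeGerm p 𝔭 h₀) :=
  OrbitTorus.push_tChar ℤ cmNumbersConj _ _ _

/-- `X^*(T^Ψ) → X^*(L^{Π(Ψ)})` is `Γ`-equivariant (so `α′^Ψ` is defined over `ℚ`). [cite: Milne1999, §5 p. 65 L2–L6] -/
theorem redChar_rep {Φ₀ : Set (K →ₐ[ℚ] cmNumbers)} (h₀ : IsCMTypeWith (cmNumbersConj : cmNumbers ≃ₐ[ℚ] cmNumbers) Φ₀)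
    (σ : cmNumbers ≃ₐ[ℚ] cmNumbers) (x : cmOrbitChar ℤ Φ₀) :
    redChar p 𝔭 h₀ (cmOrbitRep ℤ Φ₀ σ x) = weilOrbitRep ℤ (cmTypeGerm p 𝔭 h₀) σ (redChar p 𝔭 h₀ x) :=
  OrbitTorus.push_rep ℤ cmNumbersConj _ _ cmNumbersConj_mul_comm (orbitRed_smul p 𝔭 h₀) σ x

/-- **«induces a surjective homomorphism» `X^*(T^Ψ) → X^*(L^{Π(Ψ)})`** (because `Ψ → Π(Ψ)` is onto). [cite: Milne1999, §5 p. 65 L2–L5] -/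
theorem redChar_surjective {Φ₀ : Set (K →ₐ[ℚ] cmNumbers)} (h₀ : IsCMTypeWith (cmNumbersConj : cmNumbers ≃ₐ[ℚ] cmNumbers) Φ₀) : Function.Surjective (redChar p 𝔭 h₀) :=
  OrbitTorus.push_surjective ℤ cmNumbersConj _ _ (orbitRed_surjective p 𝔭 h₀)

variable (R : Type*) [CommRing R] [Algebra ℚ R]

/-- **`T^Ψ(R) = Hom_Γ(X^*(T^Ψ), (ℚ^{cm} ⊗_ℚ R)ˣ)`**, the torus `T^Ψ` through its `R`-points (Q768 `torusPoints`, as Q768's `orbitTorusPoints` for orbits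
of CM types on `ℚ^{cm}`). [cite: Milne1999, §2 p. 55 L38–L45] [cite: Milne2017, Ch. 12 Thm. 12.9] -/
abbrev cmOrbitTorusPoints (Φ₀ : Set (K →ₐ[ℚ] cmNumbers)) : Subgroup (Multiplicative (cmOrbitChar ℤ Φ₀) →* (cmNumbers ⊗[ℚ] R)ˣ) :=
  torusPoints ℚ cmNumbers R (cmOrbitRep ℤ Φ₀)

/-- **`t^Ψ : T^Ψ(R) → (ℚ^{cm} ⊗ R)ˣ`** on points (evaluation at `t^Ψ`). [cite: Milne1999, §2 p. 55 L45–L48] -/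
def tCMPoints (Φ₀ : Set (K →ₐ[ℚ] cmNumbers)) : cmOrbitTorusPoints R Φ₀ →* (cmNumbers ⊗[ℚ] R)ˣ :=
  torusPoints.eval ℚ cmNumbers R (cmOrbitRep ℤ Φ₀) (tCM ℤ Φ₀)

/-- **`α′^Ψ : L^{Π(Ψ)}(R) → T^Ψ(R)`** («hence, an injective homomorphism `α′^Ψ : (L^{Π(Ψ)}, l^{Π(Ψ)}) → (T^Ψ, t^Ψ)`»): Q768's `torusPoints.comap` of
the equivariant character map `X^*(T^Ψ) → X^*(L^{Π(Ψ)})`, for every commutative `ℚ`-algebra `R`. [cite: Milne1999, §5 p. 65 L5–L7] -/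
def alphaPrimePoints {Φ₀ : Set (K →ₐ[ℚ] cmNumbers)} (h₀ : IsCMTypeWith (cmNumbersConj : cmNumbers ≃ₐ[ℚ] cmNumbers) Φ₀) :
    weilOrbitTorusPoints R (cmTypeGerm p 𝔭 h₀) →* cmOrbitTorusPoints R Φ₀ :=
  torusPoints.comap ℚ cmNumbers R (cmOrbitRep ℤ Φ₀) (weilOrbitRep ℤ (cmTypeGerm p 𝔭 h₀)) (redChar p 𝔭 h₀) (redChar_rep p 𝔭 h₀)

variable {R} in
/-- Values: `α′^Ψ(f)(x) = f(push x)`. [cite: Milne1999, §5 p. 65 L5–L7] -/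
theorem alphaPrimePoints_apply_ofAdd {Φ₀ : Set (K →ₐ[ℚ] cmNumbers)} (h₀ : IsCMTypeWith (cmNumbersConj : cmNumbers ≃ₐ[ℚ] cmNumbers) Φ₀)
    (f : weilOrbitTorusPoints R (cmTypeGerm p 𝔭 h₀)) (x : cmOrbitChar ℤ Φ₀) :
    (alphaPrimePoints p 𝔭 R h₀ f : Multiplicative (cmOrbitChar ℤ Φ₀) →* (cmNumbers ⊗[ℚ] R)ˣ) (Multiplicative.ofAdd x) =
      (f : Multiplicative (weilOrbitChar ℤ (cmTypeGerm p 𝔭 h₀)) →* (cmNumbers ⊗[ℚ] R)ˣ)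
        (Multiplicative.ofAdd (redChar p 𝔭 h₀ x)) := rfl

variable {R} in
/-- **`t^Ψ ∘ α′^Ψ = l^{Π(Ψ)}`**: `α′^Ψ` is a morphism of PAIRS `(L^{Π(Ψ)}, l^{Π(Ψ)}) → (T^Ψ, t^Ψ)`. [cite: Milne1999, §5 p. 65 L5–L7] -/
theorem tCMPoints_alphaPrimePoints {Φ₀ : Set (K →ₐ[ℚ] cmNumbers)} (h₀ : IsCMTypeWith (cmNumbersConj : cmNumbers ≃ₐ[ℚ] cmNumbers) Φ₀)
    (f : weilOrbitTorusPoints R (cmTypeGerm p 𝔭 h₀)) :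
    tCMPoints R Φ₀ (alphaPrimePoints p 𝔭 R h₀ f) = lWeilPoints R (cmTypeGerm p 𝔭 h₀) f :=
  (alphaPrimePoints_apply_ofAdd p 𝔭 h₀ f (tCM ℤ Φ₀)).trans
    ((congrArg (fun x : weilOrbitChar ℤ (cmTypeGerm p 𝔭 h₀) =>
        (f : Multiplicative (weilOrbitChar ℤ (cmTypeGerm p 𝔭 h₀)) →* (cmNumbers ⊗[ℚ] R)ˣ) (Multiplicative.ofAdd x))
      (redChar_tCM p 𝔭 h₀)).trans (lWeilPoints_apply R _ f).symm)

variable {R} in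
/-- **`α′^Ψ` IS INJECTIVE** on `R`-points for every commutative `ℚ`-algebra `R`: a point of `L^{Π(Ψ)}` is a homomorphism on `X^*(L^{Π(Ψ)})`, which is
the image of `X^*(T^Ψ)` («an injective homomorphism `α′^Ψ`»; Milne assembles these into the injective `α′^K : (L^K, l^K) → (T^K, t^K)` — for that
every `Π` must be a `Π(Ψ)`, §5 below). [cite: Milne1999, §5 p. 65 L5–L9] -/
theorem alphaPrimePoints_injective {Φ₀ : Set (K →ₐ[ℚ] cmNumbers)} (h₀ : IsCMTypeWith (cmNumbersConj : cmNumbers ≃ₐ[ℚ] cmNumbers) Φ₀) :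
    Function.Injective (alphaPrimePoints p 𝔭 R h₀) := by
  intro f₁ f₂ h
  apply Subtype.ext
  apply MonoidHom.ext
  intro x
  obtain ⟨y, hy⟩ := redChar_surjective p 𝔭 h₀ (Multiplicative.toAdd x)
  have hx : x = Multiplicative.ofAdd (redChar p 𝔭 h₀ y) := by rw [hy, ofAdd_toAdd]
  have h1 := congrArg (fun F : cmOrbitTorusPoints R Φ₀ =>
    (F : Multiplicative (cmOrbitChar ℤ Φ₀) →* (cmNumbers ⊗[ℚ] R)ˣ) (Multiplicative.ofAdd y)) h
  rw [hx]
  exact h1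

end AlphaPrime

/-! ### §4 The `{0,1}`-valued lift: CM types with prescribed fibre sums -/

namespace FibreSum

section ZeroOne

variable {G : Type*} [Group G] [Fintype G] {Y : Type*} [MulAction G Y] [DecidableEq Y] (w₀ : Y) (ι : G) (hι : ι * ι = 1)
variable (f : Y → ℤ)

open scoped Classical in
/-- **the `{0,1}`-valued lift**: for `σ` with `w = σw₀`, `g(σ) = [σ = rep σ]` if `ιw = w`; `= [σ ∈ A(w)]` if `ιw ≠ w = rep w`;
`= [ισ ∉ A(ιw)]` otherwise — `A(w) ⊆ fib(w)` a chosen subset of size `f(w)` [cite: Milne1999, §5 p. 63 Lemma 5.1 (L13–L15)] -/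
def liftSet (A : Y → Finset G) : G → ℤ := fun σ =>
  if ι • σ • w₀ = σ • w₀ then (if pairRep ι hι σ = σ then 1 else 0)
  else if pairRep ι hι (σ • w₀) = σ • w₀ then (if σ ∈ A (σ • w₀) then 1 else 0)
  else (if ι * σ ∈ A (ι • σ • w₀) then 0 else 1)

omit [Fintype G] in
open scoped Classical in
/-- values in `{0,1}` [cite: Milne1999, §5 p. 63 Lemma 5.1 (L13–L15)] -/
theorem liftSet_zeroOne (A : Y → Finset G) (σ : G) : liftSet w₀ ι hι A σ = 0 ∨ liftSet w₀ ι hι A σ = 1 := by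
  unfold liftSet
  split_ifs <;> simp

omit [Fintype G] in
open scoped Classical in
/-- **(i) `g(σ) + g(ισ) = 1`** [cite: Milne1999, §5 p. 63 Lemma 5.1 (L13–L15)] -/
theorem liftSet_add_liftSet_mul (hι1 : ι ≠ 1) (A : Y → Finset G) (σ : G) :
    liftSet w₀ ι hι A σ + liftSet w₀ ι hι A (ι * σ) = 1 := by
  have hne : ι * σ ≠ σ := fun h => hι1 (by simpa using h)
  have hιι : ι • ι • σ • w₀ = σ • w₀ := by rw [smul_smul, hι, one_smul]
  unfold liftSet
  simp only [mul_smul]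
  by_cases hA : ι • σ • w₀ = σ • w₀
  · rw [if_pos hA, hA, if_pos hA]
    have hrep := pairRep_smul ι hι (X := G) σ
    rw [smul_eq_mul] at hrep
    rw [hrep]
    rcases pairRep_spec ι hι (X := G) σ with h1 | h1
    · rw [if_pos h1, if_neg (show ¬pairRep ι hι σ = ι * σ by rw [h1]; exact hne.symm)]; ring
    · rw [smul_eq_mul] at h1
      rw [if_neg (show ¬pairRep ι hι σ = σ by rw [h1]; exact hne), if_pos h1]; ring
  · rw [if_neg hA]
    have hA' : ¬ι • ι • σ • w₀ = ι • σ • w₀ := by rw [hιι]; exact fun h => hA h.symm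
    rw [if_neg hA', hιι, pairRep_smul]
    by_cases hB : pairRep ι hι (σ • w₀) = σ • w₀
    · rw [if_pos hB, if_neg (show ¬pairRep ι hι (σ • w₀) = ι • σ • w₀ by rw [hB]; exact fun h => hA h.symm)]
      simp only [← mul_assoc, hι, one_mul]
      split_ifs <;> simp
    · have hC : pairRep ι hι (σ • w₀) = ι • σ • w₀ := (pairRep_spec ι hι (σ • w₀)).resolve_left hB
      rw [if_neg hB, if_pos hC]
      split_ifs <;> simp

open scoped Classical in
/-- **(ii) `Σ_{σ ∈ fib(w)} g(σ) = f(w)`**, provided `A(w) ⊆ fib(w)` has `f(w)` elements for the free representatives `w`, all fibres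
have `d` elements and `f(w) + f(ιw) = d` [cite: Milne1999, §5 p. 63 Lemma 5.1 (L13–L15)] -/
theorem sum_fibre_liftSet (hι1 : ι ≠ 1) (A : Y → Finset G)
    (hA : ∀ w, ι • w ≠ w → pairRep ι hι w = w → A w ⊆ fibre G w₀ w ∧ ((A w).card : ℤ) = f w)
    (hd : ∀ w, (fibre G w₀ w).card = (fibre G w₀ w₀).card)
    (hf : ∀ w, f w + f (ι • w) = (fibre G w₀ w₀).card) (w : Y) :
    ∑ σ ∈ fibre G w₀ w, liftSet w₀ ι hι A σ = f w := by
  have hcongr : ∀ (F : G → Y → ℤ), ∑ σ ∈ fibre G w₀ w, F σ (σ • w₀) = ∑ σ ∈ fibre G w₀ w, F σ w := fun F =>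
    Finset.sum_congr rfl fun σ hσ => by rw [(mem_fibre w₀).mp hσ]
  unfold liftSet
  rw [hcongr (fun σ v => if ι • v = v then (if pairRep ι hι σ = σ then 1 else 0)
    else if pairRep ι hι v = v then (if σ ∈ A v then 1 else 0)
    else (if ι * σ ∈ A (ι • v) then 0 else 1))]
  by_cases hAw : ι • w = w
  · simp only [if_pos hAw]
    rw [Finset.sum_boole]
    have h2 := two_mul_card_filter_pairRep w₀ ι hι hι1 hAw
    have hfw := hf w
    rw [hAw, ← hd w] at hfw
    have : (2 : ℤ) * ((fibre G w₀ w).filter fun σ => pairRep ι hι σ = σ).card = (fibre G w₀ w).card := by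
      exact_mod_cast h2
    linarith
  · simp only [if_neg hAw]
    by_cases hB : pairRep ι hι w = w
    · simp only [if_pos hB]
      rw [Finset.sum_boole]
      obtain ⟨hsub, hcard⟩ := hA w hAw hB
      have hfil : (fibre G w₀ w).filter (fun σ => σ ∈ A w) = A w := by
        ext σ
        simp only [Finset.mem_filter]
        exact ⟨fun h => h.2, fun h => ⟨hsub h, h⟩⟩
      rw [hfil]
      exact hcard
    · simp only [if_neg hB]
      have hC : pairRep ι hι w = ι • w := (pairRep_spec ι hι w).resolve_left hB
      have hιw : ι • ι • w ≠ ι • w := by rw [smul_smul, hι, one_smul]; exact fun h => hAw h.symm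
      have hrep : pairRep ι hι (ι • w) = ι • w := by rw [pairRep_smul, hC]
      obtain ⟨hsub, hcard⟩ := hA (ι • w) hιw hrep
      have h1 : ∀ σ : G, (if ι * σ ∈ A (ι • w) then (0 : ℤ) else 1) = 1 - (if ι * σ ∈ A (ι • w) then 1 else 0) := by
        intro σ; split_ifs <;> simp
      simp_rw [h1]
      rw [sum_sub_distrib, sum_const, nsmul_eq_mul, mul_one, Finset.sum_boole]
      -- `σ ↦ ισ` is a bijection `{σ ∈ fib(w) | ισ ∈ A(ιw)} ≃ A(ιw)`
      have hbij : ((fibre G w₀ w).filter fun σ => ι * σ ∈ A (ι • w)).card = (A (ι • w)).card := by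
        refine Finset.card_bij' (fun σ _ => ι * σ) (fun τ _ => ι * τ) ?_ ?_ ?_ ?_
        · intro σ hσ
          exact (Finset.mem_filter.mp hσ).2
        · intro τ hτ
          rw [Finset.mem_filter, mem_fibre, ← mul_assoc, hι, one_mul, mul_smul, (mem_fibre w₀).mp (hsub hτ), smul_smul, hι,
            one_smul]
          exact ⟨rfl, hτ⟩
        · intro σ _; rw [← mul_assoc, hι, one_mul]
        · intro τ _; rw [← mul_assoc, hι, one_mul]
      rw [hbij, hd w]
      linarith [hf w]

/-- A choice of subsets `A(w) ⊆ fib(w)` with `|A(w)| = f(w)` (possible when `0 ≤ f(w) ≤ |fib(w)|`). [cite: Milne1999, §5 p. 63 Lemma 5.1 (L13–L15)] -/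
theorem exists_choice (h0 : ∀ w, 0 ≤ f w) (hle : ∀ w, f w ≤ (fibre G w₀ w).card) :
    ∃ A : Y → Finset G, ∀ w, A w ⊆ fibre G w₀ w ∧ ((A w).card : ℤ) = f w := by
  have h : ∀ w, ∃ t : Finset G, t ⊆ fibre G w₀ w ∧ ((t.card : ℕ) : ℤ) = f w := by
    intro w
    obtain ⟨t, ht, hc⟩ := Finset.exists_subset_card_eq (s := fibre G w₀ w) (n := (f w).toNat)
      (by have := hle w; omega)
    exact ⟨t, ht, by rw [hc]; exact Int.toNat_of_nonneg (h0 w)⟩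
  choose A hA using h
  exact ⟨A, hA⟩

include hι in
/-- **the `{0,1}`-valued form of the combinatorial lemma**: for a transitive `G`-set `Y`, `ι² = 1 ≠ ι`, and `f : Y → ℤ` with
`0 ≤ f` and `f(w) + f(ιw) = |fib(w₀)|`, there is `g : G → {0,1}` with `g(σ) + g(ισ) = 1` and `Σ_{fib(w)} g = f(w)` [cite: Milne1999, §5 p. 63 Lemma 5.1 (L13–L15)] -/
theorem exists_zeroOne_sum_fibre_eq [Fintype Y] [MulAction.IsPretransitive G Y] (hι1 : ι ≠ 1) (h0 : ∀ w, 0 ≤ f w)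
    (hf : ∀ w, f w + f (ι • w) = (fibre G w₀ w₀).card) :
    ∃ g : G → ℤ, (∀ σ, g σ = 0 ∨ g σ = 1) ∧ (∀ σ, g σ + g (ι * σ) = 1) ∧ ∀ w, ∑ σ ∈ fibre G w₀ w, g σ = f w := by
  classical
  have hd : ∀ w, (fibre G w₀ w).card = (fibre G w₀ w₀).card := fun w => by
    obtain ⟨s, hs⟩ := MulAction.exists_smul_eq G w₀ w
    exact card_fibre_eq w₀ hs
  have hle : ∀ w, f w ≤ (fibre G w₀ w).card := fun w => by
    rw [hd w]; linarith [hf w, h0 (ι • w)]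
  obtain ⟨A, hA⟩ := exists_choice w₀ f h0 hle
  exact ⟨liftSet w₀ ι hι A, liftSet_zeroOne w₀ ι hι A, liftSet_add_liftSet_mul w₀ ι hι hι1 A,
    sum_fibre_liftSet w₀ ι hι f hι1 A (fun w _ _ => hA w) hd hf⟩

end ZeroOne

end FibreSum

/-! ### §5 Every Weil germ in `W^K_{1,+}(p^∞)` is the germ `π(Φ)` of a CM type `Φ` of `K`: `Π = Π(Ψ)` for every `Π` -/

section Surjective

variable {K : Type} [Field K] [NumberField K] [IsCMField K]
variable (p : ℕ) [hp : Fact p.Prime] (𝔭 : Ideal (𝓞 K)) [h𝔭 : 𝔭.LiesOver (Ideal.span {(p : ℤ)})] [h𝔭P : 𝔭.IsPrime]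
variable (τ₀ : K →ₐ[ℚ] cmNumbers)

/-- **The `{0,1}`-valued Lemma 5.1 at level `K`**: for `f : Y → ℤ` with `0 ≤ f` and `f(w) + f(ιw) = [K_{w₀} : ℚ_p]` there is a `{0,1}`-valued
`λ ∈ X^*(S^K)` with `λ + ιλ = 1` (a CM type of `K`) and fibre sums `Σ_{σw₀ = w} λ(τ₀σ) = f(w)` — transport of `FibreSum.exists_zeroOne_sum_fibre_eq`
along `autEquivEmb τ₀`, as in g16-#3's `exists_infinityTypes_sum_fibre_eq`. [cite: Milne1999, §5 p. 63 Lemma 5.1 (L13–L15)] [cite: Milne1999, §5 pp. 64–65 («The reduction functor»)] -/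
theorem exists_zeroOne_infinityTypes_sum_fibre_eq [IsGalois ℚ K] (f : primesOverSet p K → ℤ) (h0 : ∀ w, 0 ≤ f w)
    (hf : ∀ w, f w + f ((conjGal : K ≃ₐ[ℚ] K) • w) = localDegree 𝔭) :
    ∃ g ∈ infinityTypes (cmNumbers ≃ₐ[ℚ] cmNumbers) (K →ₐ[ℚ] cmNumbers) cmNumbersConj,
      (∀ τ, g τ = 0 ∨ g τ = 1) ∧ (∀ τ, g τ + g (cmNumbersConj • τ) = 1) ∧
        ∀ w : primesOverSet p K,
          ∑ σ ∈ Finset.univ.filter (fun σ : K ≃ₐ[ℚ] K => σ • basePrime p 𝔭 = w), g (embOfAut τ₀ σ) = f w := by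
  haveI := Fintype.ofFinite (primesOverSet p K)
  have hf' : ∀ w, f w + f ((conjGal : K ≃ₐ[ℚ] K) • w) =
      (FibreSum.fibre (K ≃ₐ[ℚ] K) (basePrime p 𝔭) (basePrime p 𝔭)).card := by
    intro w; rw [card_fibre_basePrime]; exact hf w
  have key := FibreSum.exists_zeroOne_sum_fibre_eq (G := K ≃ₐ[ℚ] K) (basePrime p 𝔭) conjGal conjGal_mul_conjGal f
    conjGal_ne_one h0
  obtain ⟨g₀, h01, hg₀, hsum⟩ := key hf'
  have hall : ∀ x : K →ₐ[ℚ] cmNumbers,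
      g₀ ((autEquivEmb τ₀).symm x) + g₀ ((autEquivEmb τ₀).symm (cmNumbersConj • x)) = 1 := by
    intro x
    obtain ⟨σ, rfl⟩ := (autEquivEmb τ₀).surjective x
    rw [autEquivEmb_apply, cmNumbersConj_smul_embOfAut, ← autEquivEmb_apply, ← autEquivEmb_apply, Equiv.symm_apply_apply,
      Equiv.symm_apply_apply]
    exact hg₀ σ
  refine ⟨fun τ => g₀ ((autEquivEmb τ₀).symm τ), ?_, fun τ => h01 _, hall, fun w => ?_⟩
  · rw [mem_infinityTypes_iff_of_comm (fun σ x => AlgHom.ext fun y => by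
      simp only [algEquiv_smul_apply]; exact cmNumbersConj_comm σ (x y))]
    intro σ x
    have hinv : cmNumbersConj⁻¹ = cmNumbersConj := inv_eq_of_mul_eq_one_right cmNumbersConj_mul_self
    rw [hinv, hall, hall]
  · rw [← fibre_eq_filter, ← hsum w]
    refine Finset.sum_congr rfl fun σ _ => ?_
    dsimp only
    rw [← autEquivEmb_apply, Equiv.symm_apply_apply]

omit [IsCMField K] in
/-- A `{0,1}`-valued `λ : Hom(K, ℚ^{cm}) → ℤ` with `λ + ιλ = 1` is the character `λ_Φ` of the CM type `Φ = {λ = 1}`.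
[cite: MilneShih1982Taniyama, §1 (1.7)] [cite: MilneCM2006, Ch. I §1 Def. 1.8] -/
theorem isCMTypeWith_setOf_eq_one {g : (K →ₐ[ℚ] cmNumbers) → ℤ} (h01 : ∀ τ, g τ = 0 ∨ g τ = 1)
    (h1 : ∀ τ, g τ + g (cmNumbersConj • τ) = 1) :
    IsCMTypeWith (cmNumbersConj : cmNumbers ≃ₐ[ℚ] cmNumbers) {τ : K →ₐ[ℚ] cmNumbers | g τ = 1} where
  mem_iff τ := by
    simp only [Set.mem_setOf_eq]
    have h := h1 τ
    rcases h01 τ with h0 | h0 <;> rcases h01 (cmNumbersConj • τ) with h0' | h0' <;> omega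
  comm σ τ := by rw [smul_smul, smul_smul, cmNumbersConj_mul_comm σ]
  invol τ := by rw [smul_smul, cmNumbersConj_mul_self, one_smul]

/-- … and `λ_{{λ = 1}} = λ`. [cite: MilneShih1982Taniyama, §1 (1.7)] -/
theorem coe_cmTypeChar_setOf_eq_one {g : (K →ₐ[ℚ] cmNumbers) → ℤ} (h01 : ∀ τ, g τ = 0 ∨ g τ = 1)
    (h1 : ∀ τ, g τ + g (cmNumbersConj • τ) = 1) :
    (cmTypeChar (isCMTypeWith_setOf_eq_one h01 h1) : (K →ₐ[ℚ] cmNumbers) → ℤ) = g := by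
  funext τ
  rcases h01 τ with h | h
  · rw [h, cmTypeChar_apply_of_notMem]
    simp [h]
  · rw [h, cmTypeChar_apply_of_mem]
    exact h

/-- **EVERY GERM IN `W^K_{1,+}(p^∞)` IS THE GERM `π(Φ)` OF A CM TYPE `Φ` OF `K`** (`K` CM, Galois over `ℚ`): `π : {CM types of K} → W^K_{1,+}(p^∞)`
is ONTO.  Proof: the invariants `f = f_x` of `x ∈ W^K_{1,+}(p^∞)` satisfy `0 ≤ f`, `f + ιf = [K_w : ℚ_p]` (g16-#5 `mem_weilLimitInOnePlus_iff_fInvLim`);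
the `{0,1}`-valued Lemma 5.1 gives a CM type `λ` with `f_{π(λ)} = f` ((5.1), g16-#2 `fInvHom_alphaUnitIn`), and `[π] ↦ f_π` is injective (g16-#3
`fInvLim_injective`).  Not printed in [Milne1999]; it is what the assembly of the `α′^Ψ` into an injective `α′^K : (L^K, l^K) → (T^K, t^K)` over ALL
`Γ`-orbits `Π ⊂ W^K_{1,+}(p^∞)` («On combining these maps for all `Ψ`») uses: every `Π` is a `Π(Ψ)`. [cite: Milne1999, §5 p. 65 L8–L9, pp. 64–65 («The reduction functor»)] -/
theorem exists_cmTypeGerm_eq [IsGalois ℚ K] {x : WeilLimit p} (hx : x ∈ weilLimitInOnePlus K p τ₀) :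
    ∃ (Φ : Set (K →ₐ[ℚ] cmNumbers)) (h : IsCMTypeWith (cmNumbersConj : cmNumbers ≃ₐ[ℚ] cmNumbers) Φ), cmTypeGerm p 𝔭 h = x := by
  -- the invariants of `x`
  set f := (fInvLim p τ₀ ⟨x, hx.1⟩).toAdd with hfdef
  have hf := (mem_weilLimitInOnePlus_iff_fInvLim p τ₀ ⟨x, hx.1⟩).mp hx
  have hf1 : ∀ w, f w + f ((conjGal : K ≃ₐ[ℚ] K) • w) = localDegree 𝔭 := fun w => by
    rw [hf.2 w, localDegree_eq_of_isGalois p w (basePrime p 𝔭)]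
  obtain ⟨g, hg, h01, h1, hsum⟩ := exists_zeroOne_infinityTypes_sum_fibre_eq p 𝔭 τ₀ f hf.1 hf1
  refine ⟨{τ | g τ = 1}, isCMTypeWith_setOf_eq_one h01 h1, ?_⟩
  -- `π(Φ) = π(g)` and `f_{π(g)} = f = f_x`
  have hchar : cmTypeChar (isCMTypeWith_setOf_eq_one h01 h1) =
      (⟨g, hg⟩ : infinityTypes (cmNumbers ≃ₐ[ℚ] cmNumbers) (K →ₐ[ℚ] cmNumbers) cmNumbersConj) :=
    Subtype.ext (coe_cmTypeChar_setOf_eq_one h01 h1)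
  rw [cmTypeGerm_def, hchar, ← weilGerm_toWeilGroup_alphaUnitIn p 𝔭 τ₀]
  have hmem := weilGerm_toWeilGroup_mem_weilLimitIn p τ₀ (alphaUnitIn p 𝔭 τ₀ ⟨g, hg⟩)
  suffices h : (⟨weilGerm (primeLevel p 𝔭) (toWeilGroup τ₀ (alphaUnitIn p 𝔭 τ₀ ⟨g, hg⟩)), hmem⟩ : weilLimitIn K p τ₀) =
      ⟨x, hx.1⟩ from congrArg Subtype.val h
  apply fInvLim_injective p τ₀
  rw [fInvLim_mk]
  apply Multiplicative.toAdd.injective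
  rw [← hfdef]
  funext w
  rw [fInvHom_alphaUnitIn, ← fibre_eq_filter]
  have := hsum w
  rw [← fibre_eq_filter] at this
  exact this

/-- **Every `Γ`-orbit `Π ⊂ W^K_{1,+}(p^∞)` is `Π(Ψ)` for a `Γ`-orbit `Ψ` of CM types of `K`.** [cite: Milne1999, §5 pp. 64–65 («The reduction functor»), p. 65 L8–L9] -/
theorem exists_orbit_eq_orbit_cmTypeGerm [IsGalois ℚ K] {x : WeilLimit p} (hx : x ∈ weilLimitInOnePlus K p τ₀) :
    ∃ (Φ : Set (K →ₐ[ℚ] cmNumbers)) (h : IsCMTypeWith (cmNumbersConj : cmNumbers ≃ₐ[ℚ] cmNumbers) Φ),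
      MulAction.orbit (cmNumbers ≃ₐ[ℚ] cmNumbers) x = MulAction.orbit (cmNumbers ≃ₐ[ℚ] cmNumbers) (cmTypeGerm p 𝔭 h) := by
  obtain ⟨Φ, h, he⟩ := exists_cmTypeGerm_eq p 𝔭 τ₀ hx
  exact ⟨Φ, h, by rw [he]⟩

end Surjective

end CMNumbers

end Literature.NumberTheory.ComplexMultiplication

end
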